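import Summits.CriticalPhenomena.PercolationContinuityZ3.Theorems.Transplant.GrigorchukTimesZLabelRigidity
import Summits.CriticalPhenomena.PercolationContinuityZ3.Theorems.Transplant.GrigorchukCayleyAutGroup
import HarnessLib

/-!
# `Aut(Cay(𝔊 × ℤ; a, b, c, d, z)) = (𝔊 × ℤ) ⋊ C₂`: every automorphism is a left translation, possibly composed with the flip `(g, n) ↦ (g, −n)`; hence every
# automorphism has a power that is a translation of the `ℤ` factor (part III of O19b)

builds on p205010 (kernel theorem, internal audit signed; external expert review pending) — nothing in this file uses p205010; graph theory of ONE Cayley graph, no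
percolation statement, nothing about any `@[conjecture]` (MUST-NOTs stand; `θ(p_c)` on this graph is NOT proved in tree or print).  Lane `prim-bschramm`, seat
`prim-bschramm-p3` gen 39 (DESIGN OWNER; `P3-NILPOTENT.md` §32.3, item O19b; GO lead g26 #8453, refuter-first).  Helper file (`--supports stmt-CriticalPhenomena-4575 --as helper`).
Defs: `flipG` (the group automorphism `(g, n) ↦ (g, −n)`), `flipIso` (it is a graph automorphism), `leftMulHomP` (left translations); no instance, no notation.

CONTENT.  §6 the flip; §7 the SIGN of an automorphism (`φ (u·z) = φ u·z` or `= φ u·z⁻¹`, label rigidity p-«GrigorchukTimesZLabelRigidity») is CONSTANT in `u`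
(tree letters commute with `z`; along `z`-edges by injectivity) — closure induction over `𝔊 × ℤ = ⟨a, b, c, d, z⟩`; hence the DICHOTOMY `gzCay_aut_dichotomy`:
`(∀ u, φ u = φ 1 · u) ∨ (∀ u, φ u = φ 1 · flip u)`; §8 consequences: `gzCay_aut_sq_or_self_leftMul` and **`exists_pow_eq_transl (α) : ∃ n > 0, ∃ j : ℤ, ∀ w,
(α ^ n) w = (1, z^j) · w`** — every automorphism has a positive power translating the `ℤ` factor (for `L_{(h,m)}`: `n = |h|` by Grigorchuk's torsion theorem
p615715; for `L_{(h,m)} ∘ flip`: `α² = L_{(h², 0)}`).  The customers (rank ≤ 1 of every character; no orbit datum / quasi-step datum / planar skeleton) are the sequel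
«GrigorchukTimesZNoInput».
[cite: Grigorchuk1980, every element of 𝔊 has finite order; relations of 𝔊] [cite: BenjaminiSchramm1996, §2 (Cayley graphs)]
[cite: LeemannDeLaSalle2022, Thm. 1.1 (context: Cayley graphs with few automorphisms; this generating set is not treated there)]
-/

noncomputable section

namespace Summit.CriticalPhenomena.PercolationContinuityZ3.Theorems.Transplant

namespace Grigorchuk

open SimpleGraph
open scoped Classical

/-! ### §6 The flip `(g, n) ↦ (g, −n)` -/

/-- **The flip** `(g, n) ↦ (g, −n)`, a group automorphism of `𝔊 × ℤ` (inversion on the abelian factor). [folklore] -/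
def flipG : GZ ≃* GZ := MulEquiv.prodCongr (MulEquiv.refl ↥grigorchukGroup) (MulEquiv.inv (Multiplicative ℤ))

/-- `flip (g, m) = (g, m⁻¹)`. [folklore] -/
@[simp] theorem flipG_apply (g : ↥grigorchukGroup) (m : Multiplicative ℤ) : flipG (g, m) = (g, m⁻¹) := rfl

/-- The flip is an involution. [folklore] -/
theorem flipG_flipG (x : GZ) : flipG (flipG x) = x := by
  obtain ⟨g, m⟩ := x
  rw [flipG_apply, flipG_apply, inv_inv]

/-- The flip fixes `a, b, c, d` and exchanges `z`, `z⁻¹`: it permutes the six letters. [folklore] -/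
theorem flipG_toP (y : L6) : ∃ y' : L6, flipG (L6.toP y) = L6.toP y' := by
  cases y
  · exact ⟨.a, Prod.ext rfl inv_one⟩
  · exact ⟨.b, Prod.ext rfl inv_one⟩
  · exact ⟨.c, Prod.ext rfl inv_one⟩
  · exact ⟨.d, Prod.ext rfl inv_one⟩
  · exact ⟨.si, by rw [L6.toP, L6.toP, zP, Prod.inv_mk, flipG_apply, inv_one]⟩
  · exact ⟨.s, by rw [L6.toP, L6.toP, zP, Prod.inv_mk, flipG_apply, inv_one, inv_inv]⟩

/-- `flip z = z⁻¹` and `flip z⁻¹ = z`. [folklore] -/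
theorem flipG_zP : flipG zP = zP⁻¹ ∧ flipG zP⁻¹ = zP :=
  ⟨by rw [zP, Prod.inv_mk, flipG_apply, inv_one], by rw [zP, Prod.inv_mk, flipG_apply, inv_one, inv_inv]⟩

/-- **The flip is a graph automorphism of `Cay(𝔊 × ℤ; a, b, c, d, z)`.** [cite: BenjaminiSchramm1996, §2 (Cayley graphs)] -/
def flipIso : gzCay ≃g gzCay where
  toEquiv := flipG.toEquiv
  map_rel_iff' := by
    intro u w
    change gzCay.Adj (flipG u) (flipG w) ↔ gzCay.Adj u w
    constructor
    · intro h
      obtain ⟨y, hy⟩ := gzCay_adj_iff.1 h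
      obtain ⟨y', hy'⟩ := flipG_toP y
      refine gzCay_adj_iff.2 ⟨y', ?_⟩
      rw [← flipG_flipG w, hy, map_mul, flipG_flipG, hy']
    · intro h
      obtain ⟨y, rfl⟩ := gzCay_adj_iff.1 h
      obtain ⟨y', hy'⟩ := flipG_toP y
      exact gzCay_adj_iff.2 ⟨y', by rw [map_mul, hy']⟩

/-- `flipIso x = flip x`. [folklore] -/
@[simp] theorem flipIso_apply (x : GZ) : flipIso x = flipG x := rfl

/-! ### §7 The sign of an automorphism is constant; the dichotomy -/

/-- `z² ≠ 1` (the `ℤ` factor is torsion-free). [folklore] -/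
theorem zP_mul_zP_ne_one : zP * zP ≠ 1 := by
  intro h
  have h2 := congrArg (fun x : GZ => Multiplicative.toAdd x.2) h
  simp only [zP, Prod.snd_mul, Prod.snd_one, toAdd_mul, toAdd_ofAdd, toAdd_one] at h2
  omega

/-- The two possible images of a `z`-edge are different: `v·z ≠ v·z⁻¹`. [folklore] -/
theorem mul_zP_ne_mul_inv (v : GZ) : v * zP ≠ v * zP⁻¹ := by
  intro h
  have h1 : zP = zP⁻¹ := mul_left_cancel h
  exact zP_mul_zP_ne_one (mul_eq_one_iff_eq_inv.2 h1)

/-- **Along an `a`- or tree-letter edge the sign is preserved** (`y` commutes with `z`). [folklore] -/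
theorem pos_mul_tree_iff (φ : gzCay ≃g gzCay) (u : GZ) (y : L6) (hy : y = .a ∨ y.isTree = true) :
    φ (u * L6.toP y * zP) = φ (u * L6.toP y) * zP ↔ φ (u * zP) = φ u * zP := by
  have hc : u * L6.toP y * zP = u * zP * L6.toP y := by rw [mul_assoc, ← zP_comm y, mul_assoc]
  rw [hc, gzCay_aut_mul_tree φ (u * zP) y hy, gzCay_aut_mul_tree φ u y hy]
  constructor
  · intro h
    rcases (gzCay_label_rigid φ u).2.2.2.2 with h' | h'
    · exact h'
    · exfalso
      rw [h', mul_assoc, mul_assoc, ← zP_comm y] at h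
      have h2 : zP⁻¹ = zP := mul_right_cancel (mul_left_cancel h)
      exact zP_mul_zP_ne_one (mul_eq_one_iff_eq_inv.2 h2.symm)
  · intro h; rw [h, mul_assoc, mul_assoc, zP_comm y]

/-- **Along a `z`-edge the sign is preserved** (else `φ (u z z) = φ u`, contradicting injectivity). [folklore] -/
theorem pos_mul_zP_iff (φ : gzCay ≃g gzCay) (u : GZ) : φ (u * zP * zP) = φ (u * zP) * zP ↔ φ (u * zP) = φ u * zP := by
  have hne : u * zP * zP ≠ u := by
    intro h; rw [mul_assoc] at h; exact zP_mul_zP_ne_one (mul_eq_left.1 h)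
  constructor
  · intro h
    rcases (gzCay_label_rigid φ u).2.2.2.2 with h' | h'
    · exact h'
    · exfalso
      rw [h', inv_mul_cancel_right] at h
      exact hne (φ.injective h)
  · intro h
    rcases (gzCay_label_rigid φ (u * zP)).2.2.2.2 with h' | h'
    · exact h'
    · exfalso
      rw [h, mul_inv_cancel_right] at h'
      exact hne (φ.injective h')

/-- **`𝔊 × ℤ = ⟨a, b, c, d, z⟩`.** [cite: Grigorchuk1980, definition of the group] -/
theorem closure_gzGens : Subgroup.closure (↑gzGens : Set GZ) = ⊤ := by
  rw [eq_top_iff]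
  rintro ⟨g, m⟩ -
  have h1 : ((g, 1) : GZ) ∈ Subgroup.closure (↑gzGens : Set GZ) := by
    have hg : g ∈ Subgroup.closure ({aG, bG, cG, dG} : Set ↥grigorchukGroup) := by rw [closure_gens_eq_top]; trivial
    have h := Subgroup.mem_map_of_mem (MonoidHom.inl ↥grigorchukGroup (Multiplicative ℤ)) hg
    rw [MonoidHom.map_closure] at h
    refine Subgroup.closure_mono ?_ h
    rintro _ ⟨x, hx, rfl⟩
    simp only [Set.mem_insert_iff, Set.mem_singleton_iff] at hx
    simp only [gzGens, Finset.coe_insert, Finset.coe_singleton, Set.mem_insert_iff, Set.mem_singleton_iff, MonoidHom.inl_apply]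
    rcases hx with rfl | rfl | rfl | rfl
    · exact Or.inl rfl
    · exact Or.inr (Or.inl rfl)
    · exact Or.inr (Or.inr (Or.inl rfl))
    · exact Or.inr (Or.inr (Or.inr (Or.inl rfl)))
  have h2 : ((1, m) : GZ) ∈ Subgroup.closure (↑gzGens : Set GZ) := by
    have hz : zP ∈ Subgroup.closure (↑gzGens : Set GZ) := Subgroup.subset_closure (by simp [gzGens])
    have h := Subgroup.zpow_mem _ hz (Multiplicative.toAdd m)
    have e : zP ^ (Multiplicative.toAdd m) = ((1, m) : GZ) := by
      change (MonoidHom.inr ↥grigorchukGroup (Multiplicative ℤ) (Multiplicative.ofAdd 1)) ^ (Multiplicative.toAdd m) = _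
      rw [← map_zpow, ← ofAdd_zsmul, smul_eq_mul, mul_one, ofAdd_toAdd]
      rfl
    rwa [e] at h
  have e : ((g, m) : GZ) = (g, 1) * (1, m) := Prod.ext (mul_one g).symm (one_mul m).symm
  rw [e]
  exact Subgroup.mul_mem _ h1 h2

/-- **The sign is constant**: `φ (u·z) = φ u·z ↔ φ z = φ 1·z`, for every vertex `u`. [folklore] -/
theorem pos_iff_pos_one (φ : gzCay ≃g gzCay) (u : GZ) : φ (u * zP) = φ u * zP ↔ φ zP = φ 1 * zP := by
  have key : ∀ g ∈ Subgroup.closure (↑gzGens : Set GZ), ∀ w : GZ, φ (w * g * zP) = φ (w * g) * zP ↔ φ (w * zP) = φ w * zP := by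
    intro g hg
    induction hg using Subgroup.closure_induction with
    | mem x hx =>
      intro w
      obtain ⟨y, rfl⟩ := mem_gzGens_or_inv_iff.1 (Or.inl (Finset.mem_coe.1 hx))
      cases y
      · exact pos_mul_tree_iff φ w .a (Or.inl rfl)
      · exact pos_mul_tree_iff φ w .b (Or.inr rfl)
      · exact pos_mul_tree_iff φ w .c (Or.inr rfl)
      · exact pos_mul_tree_iff φ w .d (Or.inr rfl)
      · exact pos_mul_zP_iff φ w
      · have h := pos_mul_zP_iff φ (w * L6.si.toP)
        rw [show w * L6.si.toP * zP = w by rw [L6.toP, mul_assoc, inv_mul_cancel, mul_one]] at h ⊢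
        exact h.symm
    | one => intro w; rw [mul_one]
    | mul x y _ _ hx hy => intro w; rw [← mul_assoc, hy, hx]
    | inv x _ hx =>
      intro w
      have h := hx (w * x⁻¹)
      rw [inv_mul_cancel_right] at h
      exact h.symm
  have h := key u (by rw [closure_gzGens]; trivial) 1
  rw [one_mul, one_mul] at h
  exact h

/-- **A positive automorphism is a left translation**: if `φ z = φ 1·z` then `φ u = φ 1·u` for all `u`. [folklore] -/
theorem gzCay_aut_apply_of_pos (φ : gzCay ≃g gzCay) (hpos : φ zP = φ 1 * zP) (u : GZ) : φ u = φ 1 * u := by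
  have hposu : ∀ w : GZ, φ (w * zP) = φ w * zP := fun w => (pos_iff_pos_one φ w).2 hpos
  have hnegu : ∀ w : GZ, φ (w * zP⁻¹) = φ w * zP⁻¹ := fun w => by
    have h := hposu (w * zP⁻¹)
    rw [inv_mul_cancel_right] at h
    rw [h, mul_inv_cancel_right]
  have hletter : ∀ (w : GZ) (y : L6), φ (w * L6.toP y) = φ w * L6.toP y := by
    intro w y
    cases y
    · exact gzCay_aut_mul_tree φ w .a (Or.inl rfl)
    · exact gzCay_aut_mul_tree φ w .b (Or.inr rfl)
    · exact gzCay_aut_mul_tree φ w .c (Or.inr rfl)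
    · exact gzCay_aut_mul_tree φ w .d (Or.inr rfl)
    · exact hposu w
    · exact hnegu w
  have key : ∀ g ∈ Subgroup.closure (↑gzGens : Set GZ), ∀ w : GZ, φ (w * g) = φ w * g := by
    intro g hg
    induction hg using Subgroup.closure_induction with
    | mem x hx =>
      intro w
      obtain ⟨y, rfl⟩ := mem_gzGens_or_inv_iff.1 (Or.inl (Finset.mem_coe.1 hx))
      exact hletter w y
    | one => intro w; rw [mul_one, mul_one]
    | mul x y _ _ hx hy => intro w; rw [← mul_assoc, hy, hx, mul_assoc]
    | inv x _ hx =>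
      intro w
      have h := hx (w * x⁻¹)
      rw [inv_mul_cancel_right] at h
      exact eq_mul_inv_of_mul_eq h.symm
  have h := key u (by rw [closure_gzGens]; trivial) 1
  rwa [one_mul] at h

/-- **A negative automorphism is a left translation composed with the flip**: if `φ z ≠ φ 1·z` then `φ u = φ 1·flip u`. [folklore] -/
theorem gzCay_aut_apply_of_neg (φ : gzCay ≃g gzCay) (hneg : φ zP ≠ φ 1 * zP) (u : GZ) : φ u = φ 1 * flipG u := by
  -- `φ ∘ flip` is positive
  have hnegu : ∀ w : GZ, φ (w * zP) = φ w * zP⁻¹ := by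
    intro w
    rcases (gzCay_label_rigid φ w).2.2.2.2 with h | h
    · exact absurd ((pos_iff_pos_one φ w).1 h) hneg
    · exact h
  let ψ : gzCay ≃g gzCay := flipIso.trans φ
  have hψ : ∀ w, ψ w = φ (flipG w) := fun w => rfl
  have hψpos : ψ zP = ψ 1 * zP := by
    rw [hψ, hψ, flipG_zP.1, map_one]
    have h := hnegu zP⁻¹
    rw [inv_mul_cancel] at h
    rw [← mul_inv_eq_iff_eq_mul, ← h]
  have h := gzCay_aut_apply_of_pos ψ hψpos (flipG u)
  rw [hψ, hψ, flipG_flipG, map_one] at h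
  exact h

/-- **THE DICHOTOMY: every automorphism of `Cay(𝔊 × ℤ; a, b, c, d, z)` is `L_g` or `L_g ∘ flip`** (`g = φ 1`): `Aut = (𝔊 × ℤ) ⋊ C₂`.
[cite: BenjaminiSchramm1996, §2 (Cayley graphs)] [cite: Grigorchuk1980, relations of 𝔊] -/
theorem gzCay_aut_dichotomy (φ : gzCay ≃g gzCay) : (∀ u, φ u = φ 1 * u) ∨ (∀ u, φ u = φ 1 * flipG u) := by
  by_cases h : φ zP = φ 1 * zP
  · exact Or.inl (gzCay_aut_apply_of_pos φ h)
  · exact Or.inr (gzCay_aut_apply_of_neg φ h)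

/-! ### §8 Every automorphism has a positive power translating the `ℤ` factor -/

/-- Powers of an automorphism acting as a left translation: `(L_q)^k = L_{q^k}`. [folklore] -/
theorem pow_apply_of_eq_leftMul (β : gzCay ≃g gzCay) (q : GZ) (h : ∀ u, β u = q * u) : ∀ (k : ℕ) (w : GZ), (β ^ k) w = q ^ k * w := by
  intro k
  induction k with
  | zero => intro w; rw [pow_zero, pow_zero, one_mul]; rfl
  | succ k ih => intro w; rw [pow_succ, RelIso.mul_apply, ih (β w), h w, ← mul_assoc, ← pow_succ]

/-- The square of an automorphism of the second kind is the left translation by `(h², 0)` where `φ 1 = (h, m)`. [folklore] -/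
theorem sq_apply_of_flip (φ : gzCay ≃g gzCay) (h : ∀ u, φ u = φ 1 * flipG u) (w : GZ) : (φ ^ 2) w = (((φ 1).1 * (φ 1).1, 1) : GZ) * w := by
  rw [sq, RelIso.mul_apply, h (φ w), h w, map_mul, flipG_flipG, ← mul_assoc]
  congr 1
  obtain ⟨g, m⟩ := φ 1
  rw [flipG_apply, Prod.mk_mul_mk, mul_inv_cancel]

/-- **Every automorphism of `Cay(𝔊 × ℤ; a, b, c, d, z)` has a positive power that is a translation of the `ℤ` factor**: `∃ n > 0, ∃ j, αⁿ = L_{(1, z^j)}`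
(first kind: `n = |h|`, Grigorchuk's torsion theorem p615715; second kind: `α² = L_{(h², 0)}` is torsion). [cite: Grigorchuk1980, every element of 𝔊 has finite order] -/
theorem exists_pow_eq_transl (α : gzCay ≃g gzCay) :
    ∃ n : ℕ, 0 < n ∧ ∃ j : ℤ, ∀ w : GZ, (α ^ n) w = ((1, Multiplicative.ofAdd j) : GZ) * w := by
  rcases gzCay_aut_dichotomy α with h | h
  · obtain ⟨n, hn, hgn⟩ := (isTorsion_grigorchukGroup (α 1).1).exists_pow_eq_one
    refine ⟨n, hn, Multiplicative.toAdd ((α 1).2 ^ n), fun w => ?_⟩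
    rw [pow_apply_of_eq_leftMul α (α 1) h n w, ofAdd_toAdd]
    congr 1
    exact Prod.ext (by rw [Prod.pow_fst, hgn]) (by rw [Prod.pow_snd])
  · obtain ⟨n, hn, hgn⟩ := (isTorsion_grigorchukGroup ((α 1).1 * (α 1).1)).exists_pow_eq_one
    refine ⟨2 * n, by omega, 0, fun w => ?_⟩
    rw [pow_mul, pow_apply_of_eq_leftMul (α ^ 2) _ (sq_apply_of_flip α h) n w, ofAdd_zero]
    congr 1
    exact Prod.ext (by rw [Prod.pow_fst, hgn]) (by rw [Prod.pow_snd, one_pow])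

end Grigorchuk

end Summit.CriticalPhenomena.PercolationContinuityZ3.Theorems.Transplant
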